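/-
Copyright: the b2b-balaban cell (near-miss cell 7), T⁴-continuum fan-out; row NE7b ROUND-2 swarm, seat
t4-ne7b-formalise-leaf-10 (gen 5; lineage row S1c «sorted twin» of `t4/b2b-balaban-t4-ne7b-p1/LEAVES-NE7b.md`, supplier piece for the
S6g′ INSTANCE's T3b under wiring (α′), finding F-leaf10g5-1).  Released under the licence of the surrounding project.
-/
import Summits.QuantumFields.BalabanUV.T4Continuum.Support.HistorySiblingEntropySortTwin
import Summits.QuantumFields.BalabanUV.T4Continuum.Support.HistoryGenBridge

/-!
# The sorted twin CARRIES THE SAME PHYSICAL DATA: root step, root cell, last step and the multiset of physical births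
# of `P.sortR.toPGen cell c` are those of `P.toPGen cell c` (row S1c × S6g′ INSTANCE, T3b supply)

Summits-side support leaf of the T⁴-continuum cell (rung (B)+1 on a FINITE torus only; NOT infinite volume, NOT the
mass gap, NOT the Clay statement; NOT a proof of the spine estimate NE7b).  Row NE7b, route «COUNT»; sequel of leaf-10
gen 3's `HistorySiblingEntropySortTwin` (the sorted twin `Pedigree.sortR`) and leaf-09's bridge `HistoryGenBridge`
(`Pedigree.toPGen`, the census carrier `PGen` with payloads read by `cell : π → γ`).  [folklore] well-founded recursion
over the pedigree's steps, list permutations and multiset sums; nothing is quoted from print, nothing printed is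
asserted, no `[cite:]` tag, no `Prop`-valued fact minted (trigger c1).

WHY.  Under wiring (α′) (R-OWNER-22-22) the S6g′ INSTANCE counts on the SORTED twin `P.sortR.gen c` while the slot, the
root cell `cellOfR` and H3's `Realises`∕`disjoint` are read on the REALISED member `P.toPGen cellP c`; T3b reads the
counted placement off the sorted twin's births.  The two members must therefore carry the same PHYSICAL data: the same
root step and ROOT CELL (so the sorted twin's root datum sits in the slot's cell), the same last step, and the same
MULTISET of physical births `(flat label, payload)` — the order-free, name-free datum of the owner's ruling R-OWNER-23-3
on finding F-leaf10g5-1 (remedy (R-key): S12e's occupant key `(cellOf c, (ped K τ).gen c, PGen.pbirths (toPGen …))`,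
possibly mapped through the count's value map), invariant under the re-listing by construction.

WHAT.  §1 on the census carrier `PGen`: **`PGen.pbirths : PGen γ → Multiset (PEv × γ)`** (the multiset of physical births
`((j, 0, d′), payload)` — THE tree definition of this letter per R-OWNER-23-3 (3); `card_pbirths = regions`), and along a
chain of joins with the head OLDEST: `rootStep_chainJoin`, **`rootCell_chainJoin`** (the chain's root cell is the
head's), `lastStep_chainJoin`, **`pbirths_chainJoin`** (head + sum over the tail — order-free).  §2 on pedigrees:
`rootStep_partPGen` (a part's `PGen` has the root step of its flat part genealogy, under `RenewDated`), the listing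
unfoldings `toPGen_of_nil`∕`toPGen_of_cons`∕`toPGen_sortR_of_cons`∕`sortTail_perm`, and the simultaneous induction
**`sortR_toPGen_agree`** giving **`rootStep_toPGen_sortR`**, **`rootCell_toPGen_sortR`** (+ `rootCell_fst∕snd_toPGen_sortR`
= `rootAnchor`∕`rootRegion` by `rfl` for the realised reading), **`lastStep_toPGen_sortR`**, **`pbirths_toPGen_sortR`**,
`regions_toPGen_sortR`: under `HeadOldest` and `RenewDated` (both fields of H3's reading `RealisedDomainsR`: `headOldest`,
`renew_step`) the sorted twin's member `P.sortR.toPGen cell c` and the realised member `P.toPGen cell c` have the same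
root step, root cell, last step and physical birth multiset, for every component `c`; the per-part correspondence
**`partPGen_sortR_agree`** along `parts_sortR_perm`; and `toGen_toPGen_sortR : (P.sortR.toPGen cell c).toGen = P.sortR.gen c`.

HONEST SCOPE.  Bookkeeping identities about OUR carriers; `Realises` is NOT claimed for the sorted twin (its join clause
is listing-sensitive — rows S1c-opt∕S1c-X stay parked, (R-rigid) rejected by R-OWNER-23-3 (4)); the bridge «`bread` of the
placement read off the member = `pbirths` mapped through the value map» is T3b's (leaf-05), not here.  Nothing of
H3∕(B)∕BetaPertH touched; `BirthShapeNodup`∕`hmult` NOT retired; NE7b NOT proved; spine 0∕9.  HONEST DEPENDENCY (cell): continuum YM on T⁴ ⇐ BetaPertH ∧ nine spine estimates (0/9 proved);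
BetaPertH ⇐ (D1) ∧ (D4) ∧ CAP+tail; G-an2-4 gates asym, D1 and NE2/3/4.  This file changes none of it.
-/

open Literature.MathematicalPhysics.QuantumFieldTheory.Balaban1983to89
open T4PersistenceDictionary
open Summit.QuantumFields.BalabanUV.T4Continuum.HistoryAdmissible
open Summit.QuantumFields.BalabanUV.T4Continuum.HistoryGen

noncomputable section

/-! ## §1 The census carrier: physical births, and chains of joins with the head oldest -/

namespace Summit.QuantumFields.BalabanUV.T4Continuum.HistoryAdmissible.PGen

variable {γ : Type*}

/-- **THE MULTISET OF PHYSICAL BIRTHS** of a physical genealogy (owner's ruling R-OWNER-23-3, the letters of S12e's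
ORDER-FREE occupant key): one entry `(flat label, payload) = ((j, 0, d′), cell)` per constituent region (born at step
`j`, class `d′`, payload `cell` — for the realised reading `(anchor, region)`); renewals add nothing, joins ADD — so the
datum is ORDER-FREE and NAME-FREE by construction. [folklore] -/
def pbirths : PGen γ → Multiset (PEv × γ)
  | birth j d z => {(((j, 0, d) : PEv), z)}
  | renew G _ => pbirths G
  | join X Y _ => pbirths X + pbirths Y

/-- unfolding at a birth [folklore] -/
@[simp] theorem pbirths_birth (j d : ℕ) (z : γ) : (birth j d z).pbirths = {(((j, 0, d) : PEv), z)} := rfl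

/-- unfolding at a renewal [folklore] -/
@[simp] theorem pbirths_renew (G : PGen γ) (h : ℕ) : (renew G h).pbirths = G.pbirths := rfl

/-- unfolding at a join [folklore] -/
@[simp] theorem pbirths_join (X Y : PGen γ) (s : ℕ) : (join X Y s).pbirths = X.pbirths + Y.pbirths := rfl

/-- one physical birth per constituent region [folklore] -/
theorem card_pbirths : ∀ P : PGen γ, Multiset.card P.pbirths = P.regions
  | birth _ _ _ => rfl
  | renew G _ => card_pbirths G
  | join X Y _ => by rw [pbirths_join, Multiset.card_add, card_pbirths X, card_pbirths Y]; rfl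

/-- unfolding of the root cell at a join [folklore] -/
theorem rootCell_join (X Y : PGen γ) (s : ℕ) :
    (join X Y s).rootCell = if X.rootStep ≤ Y.rootStep then X.rootCell else Y.rootCell := rfl

/-- unfolding of the root step at a join [folklore] -/
theorem rootStep_join (X Y : PGen γ) (s : ℕ) : (join X Y s).rootStep = min X.rootStep Y.rootStep := rfl

/-- **ALONG A CHAIN OF JOINS WITH THE HEAD OLDEST, THE ROOT STEP IS THE HEAD'S.** [folklore] -/
theorem rootStep_chainJoin (s : ℕ) : ∀ (A : PGen γ) (Bs : List (PGen γ)),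
    (∀ B ∈ Bs, A.rootStep ≤ B.rootStep) → (chainJoin A Bs s).rootStep = A.rootStep
  | _, [], _ => rfl
  | A, B :: Bs, h => by
      have hAB : (join A B s).rootStep = A.rootStep := by
        rw [rootStep_join]; exact min_eq_left (h B List.mem_cons_self)
      rw [chainJoin, rootStep_chainJoin s (join A B s) Bs fun B' hB' => by
        rw [hAB]; exact h B' (List.mem_cons_of_mem _ hB'), hAB]

/-- **ALONG A CHAIN OF JOINS WITH THE HEAD OLDEST, THE ROOT CELL IS THE HEAD'S** (ties go to the endpoint). [folklore] -/
theorem rootCell_chainJoin (s : ℕ) : ∀ (A : PGen γ) (Bs : List (PGen γ)),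
    (∀ B ∈ Bs, A.rootStep ≤ B.rootStep) → (chainJoin A Bs s).rootCell = A.rootCell
  | _, [], _ => rfl
  | A, B :: Bs, h => by
      have hle : A.rootStep ≤ B.rootStep := h B List.mem_cons_self
      have hAB : (join A B s).rootStep = A.rootStep := by rw [rootStep_join]; exact min_eq_left hle
      have hABc : (join A B s).rootCell = A.rootCell := by rw [rootCell_join, if_pos hle]
      rw [chainJoin, rootCell_chainJoin s (join A B s) Bs fun B' hB' => by
        rw [hAB]; exact h B' (List.mem_cons_of_mem _ hB'), hABc]

/-- the last step of a chain of joins: the head's if the chain is trivial, else the join step [folklore] -/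
theorem lastStep_chainJoin (s : ℕ) : ∀ (A : PGen γ) (Bs : List (PGen γ)),
    (chainJoin A Bs s).lastStep = if Bs = [] then A.lastStep else s
  | _, [] => rfl
  | A, B :: Bs => by
      rw [chainJoin, lastStep_chainJoin s (join A B s) Bs]
      split_ifs with h <;> first | rfl | simp at *

/-- **THE PHYSICAL BIRTHS OF A CHAIN OF JOINS**: the head's plus the SUM over the tail (order-free). [folklore] -/
theorem pbirths_chainJoin (s : ℕ) : ∀ (A : PGen γ) (Bs : List (PGen γ)),
    (chainJoin A Bs s).pbirths = A.pbirths + (Bs.map pbirths).sum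
  | _, [] => by simp [chainJoin]
  | A, B :: Bs => by
      rw [chainJoin, pbirths_chainJoin s (join A B s) Bs, pbirths_join, List.map_cons, List.sum_cons, add_assoc]

end Summit.QuantumFields.BalabanUV.T4Continuum.HistoryAdmissible.PGen

/-! ## §2 Pedigrees: the sorted twin's member carries the realised member's physical data -/

namespace Summit.QuantumFields.BalabanUV.T4Continuum.HistoryGen.Pedigree

open HistorySiblingEntropyBridge

variable {α π γ : Type*} [Inhabited γ] (P : Pedigree α π) (cell : π → γ)

/-- **A PART'S `PGen` HAS THE ROOT STEP OF ITS FLAT PART GENEALOGY** (renewals dated one step after the renewed part).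
[folklore] -/
theorem rootStep_partPGen (hS : P.RenewDated) (c : α) (q : Part α π) :
    (P.partPGen cell c (P.toPGen cell) q).rootStep = (P.flatPart c q).rootStep := by
  rcases q with ⟨c', _ | _⟩ | ⟨d, x⟩
  · show (P.toPGen cell c').rootStep = (P.gen c').rootStep
    rw [P.rootStep_toPGen cell hS c', rootStep_gen]
  · show (P.toPGen cell c').rootStep = (Gen.renew (P.gen c') _ _).rootStep
    rw [Gen.rootStep_renew, P.rootStep_toPGen cell hS c', rootStep_gen]
  · rfl

/-- unfolding of the sorted twin's and the pedigree's members on an empty part list [folklore] -/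
theorem toPGen_of_nil (Q : Pedigree α π) {c : α} (h : Q.parts c = []) :
    Q.toPGen cell c = PGen.birth (Q.step c) 0 default := by
  rw [Q.toPGen_eq cell c, h]; rfl

/-- unfolding of a member on a non-empty part list: the chain of the parts' `PGen`s [folklore] -/
theorem toPGen_of_cons (Q : Pedigree α π) {c : α} {p : Part α π} {ps : List (Part α π)} (h : Q.parts c = p :: ps) :
    Q.toPGen cell c =
      chainJoin (Q.partPGen cell c (Q.toPGen cell) p) (ps.map (Q.partPGen cell c (Q.toPGen cell))) (Q.step c) := by
  rw [Q.toPGen_eq cell c, h]; rfl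

/-- **THE SIMULTANEOUS INDUCTION**: under «oldest line first» and renewal dating, the sorted twin's member and the
realised member of every component have the same root step, root cell, last step and physical birth multiset.
[folklore] -/
theorem sortR_toPGen_agree (hH : ∀ c, P.HeadOldest c) (hS : P.RenewDated) (c : α) :
    (P.sortR.toPGen cell c).rootStep = (P.toPGen cell c).rootStep ∧
      (P.sortR.toPGen cell c).rootCell = (P.toPGen cell c).rootCell ∧
        (P.sortR.toPGen cell c).lastStep = (P.toPGen cell c).lastStep ∧
          (P.sortR.toPGen cell c).pbirths = (P.toPGen cell c).pbirths := by
  -- the parts' `PGen`s agree (older components by induction)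
  have hpart : ∀ q ∈ P.parts c,
      (P.sortR.partPGen cell c (P.sortR.toPGen cell) q).rootStep = (P.partPGen cell c (P.toPGen cell) q).rootStep ∧
        (P.sortR.partPGen cell c (P.sortR.toPGen cell) q).rootCell = (P.partPGen cell c (P.toPGen cell) q).rootCell ∧
          (P.sortR.partPGen cell c (P.sortR.toPGen cell) q).lastStep = (P.partPGen cell c (P.toPGen cell) q).lastStep ∧
            (P.sortR.partPGen cell c (P.sortR.toPGen cell) q).pbirths = (P.partPGen cell c (P.toPGen cell) q).pbirths := by
    intro q hq
    rcases q with ⟨c', _ | _⟩ | ⟨d, x⟩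
    · have hlt := P.step_lt c c' false hq
      exact sortR_toPGen_agree hH hS c'
    · have hlt := P.step_lt c c' true hq
      obtain ⟨h1, h2, -, h4⟩ := sortR_toPGen_agree hH hS c'
      exact ⟨h1, h2, rfl, h4⟩
    · exact ⟨rfl, rfl, rfl, rfl⟩
  cases hps : P.parts c with
  | nil =>
      rw [toPGen_of_nil cell P hps, toPGen_of_nil cell P.sortR (P.parts_sortR_of_nil hps)]
      exact ⟨rfl, rfl, rfl, rfl⟩
  | cons p ps =>
      have hPS := P.parts_sortR_of_cons hps
      set ps' := ps.mergeSort fun q q' => decide (P.keyR c q ≤ P.keyR c q') with hps'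
      have hperm : ps'.Perm ps := List.mergeSort_perm ps _
      rw [toPGen_of_cons cell P hps, toPGen_of_cons cell P.sortR hPS]
      simp only [step_sortR]
      have hp : p ∈ P.parts c := by rw [hps]; exact List.mem_cons_self
      have hps_sub : ∀ q ∈ ps, q ∈ P.parts c := fun q hq => by rw [hps]; exact List.mem_cons_of_mem _ hq
      -- «oldest line first», read on the parts' `PGen`s (both listings)
      have hflat := P.headOldest_flat (hH c) hps
      have hold : ∀ B ∈ ps.map (P.partPGen cell c (P.toPGen cell)),
          (P.partPGen cell c (P.toPGen cell) p).rootStep ≤ B.rootStep := by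
        intro B hB
        obtain ⟨q, hq, rfl⟩ := List.mem_map.1 hB
        rw [P.rootStep_partPGen cell hS, P.rootStep_partPGen cell hS]
        exact hflat.1 q hq
      have hold' : ∀ B ∈ ps'.map (P.sortR.partPGen cell c (P.sortR.toPGen cell)),
          (P.sortR.partPGen cell c (P.sortR.toPGen cell) p).rootStep ≤ B.rootStep := by
        intro B hB
        obtain ⟨q, hq, rfl⟩ := List.mem_map.1 hB
        have hq' : q ∈ ps := hperm.mem_iff.1 hq
        rw [(hpart p hp).1, (hpart q (hps_sub q hq')).1, P.rootStep_partPGen cell hS, P.rootStep_partPGen cell hS]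
        exact hflat.1 q hq'
      refine ⟨?_, ?_, ?_, ?_⟩
      · rw [PGen.rootStep_chainJoin _ _ _ hold', PGen.rootStep_chainJoin _ _ _ hold, (hpart p hp).1]
      · rw [PGen.rootCell_chainJoin _ _ _ hold', PGen.rootCell_chainJoin _ _ _ hold, (hpart p hp).2.1]
      · rw [PGen.lastStep_chainJoin, PGen.lastStep_chainJoin, (hpart p hp).2.2.1]
        have hnil : (ps'.map (P.sortR.partPGen cell c (P.sortR.toPGen cell)) = []) =
            (ps.map (P.partPGen cell c (P.toPGen cell)) = []) := by
          rw [List.map_eq_nil_iff, List.map_eq_nil_iff, ← List.length_eq_zero_iff, ← List.length_eq_zero_iff,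
            hperm.length_eq]
        simp only [hnil]
      · rw [PGen.pbirths_chainJoin, PGen.pbirths_chainJoin, (hpart p hp).2.2.2, List.map_map, List.map_map]
        congr 1
        rw [(hperm.map _).sum_eq]
        exact congrArg List.sum (List.map_congr_left fun q hq => (hpart q (hps_sub q hq)).2.2.2)
termination_by P.step c
decreasing_by all_goals exact hlt

/-- **SAME ROOT STEP.** [folklore] -/
theorem rootStep_toPGen_sortR (hH : ∀ c, P.HeadOldest c) (hS : P.RenewDated) (c : α) :
    (P.sortR.toPGen cell c).rootStep = (P.toPGen cell c).rootStep :=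
  (P.sortR_toPGen_agree cell hH hS c).1

/-- **SAME ROOT CELL** — the sorted twin's root datum sits in the realised member's slot cell. [folklore] -/
theorem rootCell_toPGen_sortR (hH : ∀ c, P.HeadOldest c) (hS : P.RenewDated) (c : α) :
    (P.sortR.toPGen cell c).rootCell = (P.toPGen cell c).rootCell :=
  (P.sortR_toPGen_agree cell hH hS c).2.1

/-- **SAME LAST STEP.** [folklore] -/
theorem lastStep_toPGen_sortR (hH : ∀ c, P.HeadOldest c) (hS : P.RenewDated) (c : α) :
    (P.sortR.toPGen cell c).lastStep = (P.toPGen cell c).lastStep :=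
  (P.sortR_toPGen_agree cell hH hS c).2.2.1

/-- **SAME MULTISET OF PHYSICAL BIRTHS** — the order-free, name-free datum is invariant under the re-listing.
[folklore] -/
theorem pbirths_toPGen_sortR (hH : ∀ c, P.HeadOldest c) (hS : P.RenewDated) (c : α) :
    (P.sortR.toPGen cell c).pbirths = (P.toPGen cell c).pbirths :=
  (P.sortR_toPGen_agree cell hH hS c).2.2.2

/-- the sorted twin's member flattens to the sorted twin's flat genealogy (leaf-09's bridge, with renewal dating
transferred by `renewDated_sortR`) [folklore] -/
theorem toGen_toPGen_sortR (hS : P.RenewDated) (c : α) : (P.sortR.toPGen cell c).toGen = P.sortR.gen c :=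
  P.sortR.toGen_toPGen cell (renewDated_sortR P hS) c

/-- … so its number of constituent regions is unchanged as well [folklore] -/
theorem regions_toPGen_sortR (hH : ∀ c, P.HeadOldest c) (hS : P.RenewDated) (c : α) :
    (P.sortR.toPGen cell c).regions = (P.toPGen cell c).regions := by
  rw [← PGen.card_pbirths, ← PGen.card_pbirths, P.pbirths_toPGen_sortR cell hH hS c]

/-- for a product payload (the realised reading: `γ = Pt d × Finset (Pt d)`, payload = (anchor, region)) the FIRST
component of the root cell — `HistoryRealise.rootAnchor` by `rfl` — is unchanged [folklore] -/
theorem rootCell_fst_toPGen_sortR {γ₁ γ₂ : Type*} [Inhabited (γ₁ × γ₂)] (cell₂ : π → γ₁ × γ₂)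
    (hH : ∀ c, P.HeadOldest c) (hS : P.RenewDated) (c : α) :
    (P.sortR.toPGen cell₂ c).rootCell.1 = (P.toPGen cell₂ c).rootCell.1 := by
  rw [P.rootCell_toPGen_sortR cell₂ hH hS c]

/-- … and so is the SECOND component — `HistoryRealise.rootRegion` by `rfl` [folklore] -/
theorem rootCell_snd_toPGen_sortR {γ₁ γ₂ : Type*} [Inhabited (γ₁ × γ₂)] (cell₂ : π → γ₁ × γ₂)
    (hH : ∀ c, P.HeadOldest c) (hS : P.RenewDated) (c : α) :
    (P.sortR.toPGen cell₂ c).rootCell.2 = (P.toPGen cell₂ c).rootCell.2 := by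
  rw [P.rootCell_toPGen_sortR cell₂ hH hS c]

/-! ### The per-part correspondence along `parts_sortR_perm` -/

/-- **THE PART `PGen`s AGREE**: for every part `q` of `c` (the SAME parts on both sides, `mem_parts_sortR`; listed in a
different order, `parts_sortR_perm`), the sorted twin's part `PGen` and the pedigree's part `PGen` have the same root step,
root cell, last step and physical birth multiset — a new region is the same `birth` on both sides, an old part is the
older component's member (`sortR_toPGen_agree`). [folklore] -/
theorem partPGen_sortR_agree (hH : ∀ c, P.HeadOldest c) (hS : P.RenewDated) (c : α) (q : Part α π) :
    (P.sortR.partPGen cell c (P.sortR.toPGen cell) q).rootStep = (P.partPGen cell c (P.toPGen cell) q).rootStep ∧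
      (P.sortR.partPGen cell c (P.sortR.toPGen cell) q).rootCell = (P.partPGen cell c (P.toPGen cell) q).rootCell ∧
        (P.sortR.partPGen cell c (P.sortR.toPGen cell) q).lastStep = (P.partPGen cell c (P.toPGen cell) q).lastStep ∧
          (P.sortR.partPGen cell c (P.sortR.toPGen cell) q).pbirths = (P.partPGen cell c (P.toPGen cell) q).pbirths := by
  rcases q with ⟨c', _ | _⟩ | ⟨d, x⟩
  · exact P.sortR_toPGen_agree cell hH hS c'
  · obtain ⟨h1, h2, -, h4⟩ := P.sortR_toPGen_agree cell hH hS c'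
    exact ⟨h1, h2, rfl, h4⟩
  · exact ⟨rfl, rfl, rfl, rfl⟩

/-- a new region's part `PGen` is the same `birth` on both sides (same step, class and payload) [folklore] -/
theorem partPGen_sortR_new (c : α) (d : ℕ) (x : π) :
    P.sortR.partPGen cell c (P.sortR.toPGen cell) (Part.new d x) = PGen.birth (P.step c) d (cell x) := rfl

/-- **THE TWO LISTINGS OF ONE COMPONENT**: on a part list `p :: ps` the pedigree's member is the chain over
`p :: ps` and the sorted twin's member is the chain over `p :: (ps sorted by recorded shape)` — the same head, the
tail a PERMUTATION (`List.mergeSort_perm`). [folklore] -/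
theorem toPGen_sortR_of_cons {c : α} {p : Part α π} {ps : List (Part α π)} (h : P.parts c = p :: ps) :
    P.sortR.toPGen cell c =
      chainJoin (P.sortR.partPGen cell c (P.sortR.toPGen cell) p)
        ((ps.mergeSort fun q q' => decide (P.keyR c q ≤ P.keyR c q')).map (P.sortR.partPGen cell c (P.sortR.toPGen cell)))
        (P.step c) := by
  rw [toPGen_of_cons cell P.sortR (P.parts_sortR_of_cons h)]; rfl

/-- the tail listing of the sorted twin is a permutation of the pedigree's tail [folklore] -/
theorem sortTail_perm {c : α} (ps : List (Part α π)) :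
    (ps.mergeSort fun q q' => decide (P.keyR c q ≤ P.keyR c q')).Perm ps := List.mergeSort_perm ps _

end Summit.QuantumFields.BalabanUV.T4Continuum.HistoryGen.Pedigree

end
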